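import Summits.Langlands.Langlands.Theses.MirrorPairReflection
import Literature.NumberTheory.GaloisRepresentations.HeckeCharacter

/-!
# BC3 birth skeleton — child `SectorAutomorphyOfClassification` of the BC2-redirect split of `MirrorPairReflection.SectorComplement`
(crux stmt-Langlands-12840; crux-strategist `cstrat-stmt-Langlands-12840-r1`, 2026-08-17)

`SectorAutomorphyOfClassification` (B_w⁺ — THE LEAF THAT USES THE ROUTE TARGET `X = EvenReducibleResidueClassification`; VERBATIM the
registered stub `stub_sectorAutomorphyOfClassification` of line birth_MirrorPairReflection): granted X, over `K` with `[K:ℚ] = 1`, every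
irreducible `ρ : Γ_K → GL₂(ℚ̄_ℓ)`, `ℓ` odd, unramified outside `ℓ`, de Rham above `ℓ`, of residual type `ω^a ⊕ ω^b` with `a + b` even,
is Satake–Frobenius compatible a.e. with an L-algebraic cuspidal `π`.  Cut along the Galois / automorphic seam, with the tree's
own dictionary for 'induced from a Hecke character of a quadratic field' (the clause of
`SkinnerWilesDefectOne.ProModularOrdinaryClassical`, typed over `HeckeCharacter`, `valueAtUniformizer`, `inertiaDeg`):
(A) GALOIS, uses X: such a `ρ` is, a.e., the induction of an ALGEBRAIC Hecke character `θ` of a quadratic extension `E/K`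
that is not `Gal(E/K)`-invariant — X makes `ρ` diagonal on `Γ_(ℚ(√ℓ))`, Clifford gives `ρ ≅ Ind χ`, de Rham heredity +
Serre 1968 III / Weil 1956 make `χ` the character of an algebraic `θ` (type `A₀`: `ℚ(√ℓ)` is real); (B) AUTOMORPHIC, X-free:
automorphic induction of an algebraic Hecke character from a quadratic extension gives an L-algebraic cuspidal `π` on
`GL₂(𝔸_K)` with the induced Satake polynomials (Arthur–Clozel Ch. 3 Thm 6.2 / Jacquet–Langlands §12 / Maass 1949; in tree the
named facts `automorphicInduction_character` (finite order) + integral `|det|`-twist, Henniart 2012 for the infinity type).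

Shape: ≥ 2 NAMED stubs `stub_*` (the ONLY sorries of this file) and the kernel-checked composition
`SectorAutomorphyOfClassification_of : <stub₁-sig> → <stub₂-sig> → SectorAutomorphyOfClassification` (+ `SectorAutomorphyOfClassification_of_stubs`).  Context = the route file's
(the child is restated here VERBATIM from children.json; after `route edit --split` it is the route's own decl
`Summit.Langlands.Langlands.Theses.MirrorPairReflection.SectorAutomorphyOfClassification` and this local copy is deleted — post-split
version `post/birth_SectorAutomorphyOfClassification.lean` in the planner folder).
-/

noncomputable section

set_option linter.dupNamespace false

namespace Summit.Langlands.Langlands.Theses.MirrorPairReflection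

open scoped BigOperators Topology Manifold Classical MeasureTheory ProbabilityTheory Matrix InnerProductSpace ComplexConjugate ContinuousMap
open Filter Set Function TopologicalSpace MeasureTheory

/-- child `SectorAutomorphyOfClassification` (children.json statement VERBATIM). -/
def SectorAutomorphyOfClassification : Prop :=
  EvenReducibleResidueClassification → ∀ (K : Type) [Field K] [NumberField K], Module.finrank ℚ K = 1 → ∀ (hcpt : Literature.NumberTheory.Automorphic.isCompact_glFiniteIntegralLevel 2 K) (ℓ : ℕ) [Fact ℓ.Prime], ℓ ≠ 2 → ∀ (ι : PadicAlgCl ℓ ≃+* ℂ) (ρ : Literature.NumberTheory.GaloisRepresentations.FramedGaloisRep K (PadicAlgCl ℓ) 2), ρ.toGaloisRep.IsIrreducible → ((∀ᶠ v : IsDedekindDomain.HeightOneSpectrum (NumberField.RingOfIntegers K) in cofinite, ρ.IsUnramifiedAt v) ∧ ∀ (v : IsDedekindDomain.HeightOneSpectrum (NumberField.RingOfIntegers K)) (hv : ((ℓ : ℕ) : NumberField.RingOfIntegers K) ∈ v.asIdeal), (Literature.NumberTheory.PAdicHodge.fontainePstAdicCompletion v ℓ hv).IsDeRhamFramed (ρ.toLocal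 v)) → (∀ v : IsDedekindDomain.HeightOneSpectrum (NumberField.RingOfIntegers K), ((ℓ : ℕ) : NumberField.RingOfIntegers K) ∉ v.asIdeal → ρ.IsUnramifiedAt v) → ∀ (a b : ℕ), Even (a + b) → (∀ g : Field.absoluteGaloisGroup K, ‖Literature.NumberTheory.GaloisRepresentations.FramedRep.trace ρ g - ((algebraMap ℚ_[ℓ] (PadicAlgCl ℓ) (((Literature.NumberTheory.GaloisRepresentations.GaloisRep.cyclotomicCharacter K ℓ g : ℤ_[ℓ]ˣ) : ℤ_[ℓ]) : ℚ_[ℓ])) ^ a + (algebraMap ℚ_[ℓ] (PadicAlgCl ℓ) (((Literature.NumberTheory.GaloisRepresentations.GaloisRep.cyclotomicCharacter K ℓ g : ℤ_[ℓ]ˣ) : ℤ_[ℓ]) : ℚ_[ℓ])) ^ b)‖ < 1) → ∃ π : Literature.NumberTheory.Automorphic.CuspidalAutomorphicRepData 2 K hcpt, π.1.IsLAlgebraic ∧ ∀ᶠ v : IsDedekindDomain.HeightOneSpectrum (NumberField.RingOfIntegers K) in cofinite, SatakeFrobCompatibleAt ι π.1 ρ v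

namespace Cruxes.SectorAutomorphyOfClassification.Birth

/-- **stub A — in X's sector, `ρ` is induced from an algebraic Hecke character of a quadratic field (USES X)**: granted
`X`, for `[K:ℚ] = 1`, `ℓ` odd, `ρ : Γ_K → GL₂(ℚ̄_ℓ)` irreducible, pinned-geometric, unramified outside `ℓ`, of residual type
`ω^a ⊕ ω^b` with `a + b` even, there are a quadratic extension `E/K`, an ALGEBRAIC Hecke character `θ` of `E` not fixed by
`Gal(E/K)` (infinitely many places `w` with a conjugate `w'` over the same `v` and `θ(ϖ_w') ≠ θ(ϖ_w)`), such that a.e.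
`charpoly ρ(Frob_v) = ∏_(w ∣ v) (X^(f_w) − ι⁻¹(θ(ϖ_w))⁻¹)` (the tree's dictionary, as in `SkinnerWilesDefectOne`).  Proof plan:
transport `K ≃+* ℚ`; X ⇒ `ρ` diagonal on `Γ_(ℚ(√ℓ)) = Stab(r)` in some frame; index 2 + irreducibility ⇒ `ρ ≅ Ind_E^K χ`,
`E = ℚ(√ℓ)`, `χ ≠ χ^τ`; de Rham heredity ⇒ `χ` de Rham above `ℓ` ⇒ `χ = χ_θ` for an algebraic `θ` (Serre 1968 Ch. III
§2.3–3.1; `E` totally real ⇒ `θ = ψ·N^w`, Weil 1956); non-invariance from `χ ≠ χ^τ` by Chebotarev.  Why it might fail: only a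
normalisation slip (`ι⁻¹(θ(ϖ_w))⁻¹` vs `ι⁻¹(θ(ϖ_w))`, i.e. `θ` vs `θ⁻¹` — absorbed since `θ` is existential).
[cite: SerreAbelianLadic1968, Ch. III §2.3] [cite: BuzzardGeeLMS2014, Conj. 3.2.2] -/
theorem stub_inducedFromQuadraticHecke :
    EvenReducibleResidueClassification → ∀ (K : Type) [Field K] [NumberField K], Module.finrank ℚ K = 1 → ∀ (hcpt : Literature.NumberTheory.Automorphic.isCompact_glFiniteIntegralLevel 2 K) (ℓ : ℕ) [Fact ℓ.Prime], ℓ ≠ 2 → ∀ (ι : PadicAlgCl ℓ ≃+* ℂ) (ρ : Literature.NumberTheory.GaloisRepresentations.FramedGaloisRep K (PadicAlgCl ℓ) 2), ρ.toGaloisRep.IsIrreducible → ((∀ᶠ v : IsDedekindDomain.HeightOneSpectrum (NumberField.RingOfIntegers K) in cofinite, ρ.IsUnramifiedAt v) ∧ ∀ (v : IsDedekindDomain.HeightOneSpectrum (NumberField.RingOfIntegers K)) (hv : ((ℓ : ℕ) : NumberField.RingOfIntegers K) ∈ v.asIdeal), (Literature.NumberTheory.PAdicHodge.fontainePstAdicCompletion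 v ℓ hv).IsDeRhamFramed (ρ.toLocal v)) → (∀ v : IsDedekindDomain.HeightOneSpectrum (NumberField.RingOfIntegers K), ((ℓ : ℕ) : NumberField.RingOfIntegers K) ∉ v.asIdeal → ρ.IsUnramifiedAt v) → ∀ (a b : ℕ), Even (a + b) → (∀ g : Field.absoluteGaloisGroup K, ‖Literature.NumberTheory.GaloisRepresentations.FramedRep.trace ρ g - ((algebraMap ℚ_[ℓ] (PadicAlgCl ℓ) (((Literature.NumberTheory.GaloisRepresentations.GaloisRep.cyclotomicCharacter K ℓ g : ℤ_[ℓ]ˣ) : ℤ_[ℓ]) : ℚ_[ℓ])) ^ a + (algebraMap ℚ_[ℓ] (PadicAlgCl ℓ) (((Literature.NumberTheory.GaloisRepresentations.GaloisRep.cyclotomicCharacter K ℓ g : ℤ_[ℓ]ˣ) : ℤ_[ℓ]) : ℚ_[ℓ])) ^ b)‖ < 1) → (∃ (E : Type) (_ : Field E) (_ : NumberField E) (_ : Algebra K E) (_ : Module.finrank K E = 2) (θ : Literature.NumberTheory.GaloisRepresentations.HeckeCharacter E), θ.IsAlgebraic ∧ (∃ᶠ w : IsDedekindDomain.HeightOneSpectrum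 (NumberField.RingOfIntegers E) in Filter.cofinite, ∃ w' : IsDedekindDomain.HeightOneSpectrum (NumberField.RingOfIntegers E), w'.asIdeal.under (NumberField.RingOfIntegers K) = w.asIdeal.under (NumberField.RingOfIntegers K) ∧ θ.valueAtUniformizer w' ≠ θ.valueAtUniformizer w) ∧ ∀ᶠ v : IsDedekindDomain.HeightOneSpectrum (NumberField.RingOfIntegers K) in Filter.cofinite, ρ.IsUnramifiedAt v ∧ ρ.HasFrobCharpolyAt v (∏ᶠ w ∈ {w : IsDedekindDomain.HeightOneSpectrum (NumberField.RingOfIntegers E) | w.under (NumberField.RingOfIntegers K) = v}, (Polynomial.X ^ w.asIdeal.inertiaDeg (NumberField.RingOfIntegers K) - Polynomial.C (ι.symm (θ.valueAtUniformizer w)⁻¹)))) := by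
  sorry

/-- **stub B — automorphic induction of an algebraic Hecke character of a quadratic extension (X-free; KNOWN in print)**:
an irreducible `ρ : Γ_K → GL₂(ℚ̄_ℓ)` whose Frobenius polynomials are a.e. those induced from an algebraic, non-`Gal(E/K)`-
invariant Hecke character `θ` of a quadratic `E/K` is Satake–Frobenius compatible a.e. with an L-algebraic cuspidal `π` of
`GL₂(𝔸_K)`: `π = AI_E^K(θ)` (Arthur–Clozel Ch. 3 Thm 6.2 with (6.1)–(6.2) and Lemma 6.4 — cuspidal since `θ ≠ θ^τ`;
Jacquet–Langlands 1970 §12; for `E` real quadratic and `θ` of finite order these are Maass's forms of eigenvalue `1/4`,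
L-algebraic of parameter `(0,0)`).  In tree: `automorphicInduction_character` (finite-order `θ`; the algebraic case is its
`|det|^w`-twist since `E`-algebraic characters of a real quadratic field are `ψ·N^w`, and for imaginary quadratic `E` it is
Hecke–Shintani CM induction), `Henniart2012_infinityType_of_automorphicInduction` for L-algebraicity; the Satake dictionary
`satakePolynomial α = ∏ (X^f − θ(ϖ_w)) ↔ arithFrobPolyOfSatake ι q 1 α = ∏ (X^f − ι⁻¹(θ(ϖ_w))⁻¹)` (inverse roots).
Why it might fail: L-algebraicity of the `|det|^w`-twisted induction as typed by `IsLAlgebraic` (integral parameter) — a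
typing slip at most.  [cite: ArthurClozelAMS120, Ch. 3 Thm. 6.2 and Lemma 6.4] [cite: JacquetLanglands1970, Thm. 12.2]
[cite: Maass1949, Satz 26] [cite: Henniart2012, Thm. 3] -/
theorem stub_automorphicInductionQuadratic :
    ∀ (K : Type) [Field K] [NumberField K] (hcpt : Literature.NumberTheory.Automorphic.isCompact_glFiniteIntegralLevel 2 K) (ℓ : ℕ) [Fact ℓ.Prime] (ι : PadicAlgCl ℓ ≃+* ℂ) (ρ : Literature.NumberTheory.GaloisRepresentations.FramedGaloisRep K (PadicAlgCl ℓ) 2), ρ.toGaloisRep.IsIrreducible → (∃ (E : Type) (_ : Field E) (_ : NumberField E) (_ : Algebra K E) (_ : Module.finrank K E = 2) (θ : Literature.NumberTheory.GaloisRepresentations.HeckeCharacter E), θ.IsAlgebraic ∧ (∃ᶠ w : IsDedekindDomain.HeightOneSpectrum (NumberField.RingOfIntegers E) in Filter.cofinite, ∃ w' : IsDedekindDomain.HeightOneSpectrum (NumberField.RingOfIntegers E), w'.asIdeal.under (NumberField.RingOfIntegers K) = w.asIdeal.under (NumberField.RingOfIntegers K) ∧ θ.valueAtUniformizer w' ≠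 θ.valueAtUniformizer w) ∧ ∀ᶠ v : IsDedekindDomain.HeightOneSpectrum (NumberField.RingOfIntegers K) in Filter.cofinite, ρ.IsUnramifiedAt v ∧ ρ.HasFrobCharpolyAt v (∏ᶠ w ∈ {w : IsDedekindDomain.HeightOneSpectrum (NumberField.RingOfIntegers E) | w.under (NumberField.RingOfIntegers K) = v}, (Polynomial.X ^ w.asIdeal.inertiaDeg (NumberField.RingOfIntegers K) - Polynomial.C (ι.symm (θ.valueAtUniformizer w)⁻¹)))) → ∃ π : Literature.NumberTheory.Automorphic.CuspidalAutomorphicRepData 2 K hcpt, π.1.IsLAlgebraic ∧ ∀ᶠ v : IsDedekindDomain.HeightOneSpectrum (NumberField.RingOfIntegers K) in cofinite, SatakeFrobCompatibleAt ι π.1 ρ v := by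
  sorry

/-- **B_w⁺ from its two stubs**: Galois side (A, uses X) then automorphic side (B). -/
theorem SectorAutomorphyOfClassification_of :
    (EvenReducibleResidueClassification → ∀ (K : Type) [Field K] [NumberField K], Module.finrank ℚ K = 1 → ∀ (hcpt : Literature.NumberTheory.Automorphic.isCompact_glFiniteIntegralLevel 2 K) (ℓ : ℕ) [Fact ℓ.Prime], ℓ ≠ 2 → ∀ (ι : PadicAlgCl ℓ ≃+* ℂ) (ρ : Literature.NumberTheory.GaloisRepresentations.FramedGaloisRep K (PadicAlgCl ℓ) 2), ρ.toGaloisRep.IsIrreducible → ((∀ᶠ v : IsDedekindDomain.HeightOneSpectrum (NumberField.RingOfIntegers K) in cofinite, ρ.IsUnramifiedAt v) ∧ ∀ (v : IsDedekindDomain.HeightOneSpectrum (NumberField.RingOfIntegers K)) (hv : ((ℓ : ℕ) : NumberField.RingOfIntegers K) ∈ v.asIdeal), (Literature.NumberTheory.PAdicHodge.fontainePstAdicCompletion v ℓ hv).IsDeRhamFramed (ρ.toLocal v)) → (∀ v : IsDedekindDomain.HeightOneSpectrum (NumberField.RingOfIntegers K), ((ℓ : ℕ) : NumberField.RingOfIntegers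 K) ∉ v.asIdeal → ρ.IsUnramifiedAt v) → ∀ (a b : ℕ), Even (a + b) → (∀ g : Field.absoluteGaloisGroup K, ‖Literature.NumberTheory.GaloisRepresentations.FramedRep.trace ρ g - ((algebraMap ℚ_[ℓ] (PadicAlgCl ℓ) (((Literature.NumberTheory.GaloisRepresentations.GaloisRep.cyclotomicCharacter K ℓ g : ℤ_[ℓ]ˣ) : ℤ_[ℓ]) : ℚ_[ℓ])) ^ a + (algebraMap ℚ_[ℓ] (PadicAlgCl ℓ) (((Literature.NumberTheory.GaloisRepresentations.GaloisRep.cyclotomicCharacter K ℓ g : ℤ_[ℓ]ˣ) : ℤ_[ℓ]) : ℚ_[ℓ])) ^ b)‖ < 1) → (∃ (E : Type) (_ : Field E) (_ : NumberField E) (_ : Algebra K E) (_ : Module.finrank K E = 2) (θ : Literature.NumberTheory.GaloisRepresentations.HeckeCharacter E), θ.IsAlgebraic ∧ (∃ᶠ w : IsDedekindDomain.HeightOneSpectrum (NumberField.RingOfIntegers E) in Filter.cofinite, ∃ w' : IsDedekindDomain.HeightOneSpectrum (NumberField.RingOfIntegers E), w'.asIdeal.under (NumberField.RingOfIntegers K)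 = w.asIdeal.under (NumberField.RingOfIntegers K) ∧ θ.valueAtUniformizer w' ≠ θ.valueAtUniformizer w) ∧ ∀ᶠ v : IsDedekindDomain.HeightOneSpectrum (NumberField.RingOfIntegers K) in Filter.cofinite, ρ.IsUnramifiedAt v ∧ ρ.HasFrobCharpolyAt v (∏ᶠ w ∈ {w : IsDedekindDomain.HeightOneSpectrum (NumberField.RingOfIntegers E) | w.under (NumberField.RingOfIntegers K) = v}, (Polynomial.X ^ w.asIdeal.inertiaDeg (NumberField.RingOfIntegers K) - Polynomial.C (ι.symm (θ.valueAtUniformizer w)⁻¹))))) →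
    (∀ (K : Type) [Field K] [NumberField K] (hcpt : Literature.NumberTheory.Automorphic.isCompact_glFiniteIntegralLevel 2 K) (ℓ : ℕ) [Fact ℓ.Prime] (ι : PadicAlgCl ℓ ≃+* ℂ) (ρ : Literature.NumberTheory.GaloisRepresentations.FramedGaloisRep K (PadicAlgCl ℓ) 2), ρ.toGaloisRep.IsIrreducible → (∃ (E : Type) (_ : Field E) (_ : NumberField E) (_ : Algebra K E) (_ : Module.finrank K E = 2) (θ : Literature.NumberTheory.GaloisRepresentations.HeckeCharacter E), θ.IsAlgebraic ∧ (∃ᶠ w : IsDedekindDomain.HeightOneSpectrum (NumberField.RingOfIntegers E) in Filter.cofinite, ∃ w' : IsDedekindDomain.HeightOneSpectrum (NumberField.RingOfIntegers E), w'.asIdeal.under (NumberField.RingOfIntegers K) = w.asIdeal.under (NumberField.RingOfIntegers K) ∧ θ.valueAtUniformizer w' ≠ θ.valueAtUniformizer w) ∧ ∀ᶠ v : IsDedekindDomain.HeightOneSpectrum (NumberField.RingOfIntegers K) in Filter.cofinite, ρ.IsUnramifiedAt v ∧ ρ.HasFrobCharpolyAt v (∏ᶠ w ∈ {w : IsDedekindDomain.HeightOneSpectrum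 (NumberField.RingOfIntegers E) | w.under (NumberField.RingOfIntegers K) = v}, (Polynomial.X ^ w.asIdeal.inertiaDeg (NumberField.RingOfIntegers K) - Polynomial.C (ι.symm (θ.valueAtUniformizer w)⁻¹)))) → ∃ π : Literature.NumberTheory.Automorphic.CuspidalAutomorphicRepData 2 K hcpt, π.1.IsLAlgebraic ∧ ∀ᶠ v : IsDedekindDomain.HeightOneSpectrum (NumberField.RingOfIntegers K) in cofinite, SatakeFrobCompatibleAt ι π.1 ρ v) →
    SectorAutomorphyOfClassification := by
  intro hA hB hX K _ _ hK hcpt ℓ _ hℓ ι ρ hirr hgeo hur a b hab htr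
  exact hB K hcpt ℓ ι ρ hirr (hA hX K hK hcpt ℓ hℓ ι ρ hirr hgeo hur a b hab htr)

/-- The composition with the stubs plugged in. -/
theorem SectorAutomorphyOfClassification_of_stubs : SectorAutomorphyOfClassification :=
  SectorAutomorphyOfClassification_of stub_inducedFromQuadraticHecke stub_automorphicInductionQuadratic

end Cruxes.SectorAutomorphyOfClassification.Birth

end Summit.Langlands.Langlands.Theses.MirrorPairReflection

end
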